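import Mathlib.Algebra.Polynomial.Eval.Defs
import Mathlib.Algebra.Field.ZMod
import Literature.Computability.QuantumComplexity.ShallowCircuitRelations
import Literature.Computability.QuantumComplexity.ShallowCircuitsRing
import Literature.Computability.Complexity.ConstantDepth
import Literature.Computability.MetaComplexity.SmolenskyProperty
import HarnessLib
import HarnessLib.Audit.Tags

/-!
# Rung leaf F-Q1 (cell qa-qnc0): advice-free `QNC⁰ ⊄ FAC⁰[p]` for relation problems — STATEMENTS ONLY

This module is the RUNG LEAF of cell qa-qnc0 (D-0059/D-0061 alt-closer of `QuantumAdvantage/QuantumAdvantage`,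
ledger item `defn-AdviceFreeQNC0`): it declares the printed-open problem and the cell's crux as named `Prop`s and
ASSERTS NOTHING — the closed leaf `AdviceFreeQNC0 : Prop := AdviceFreeQNC0Sep 2` is tagged `@[conjecture]`
(an obligation node, provable/refutable by name, never a vendored fact); route `RingFrame` (planner seats
qa-qnc0-p1/p2) concludes it BY NAME (`closes : RingToElim → … → AdviceFreeQNC0`). Text = prover seat
qa-qnc0-prover's `route-kit/Targets_PREFERRED.lean` (farm rc 0, 2026-08-25T19:16Z) verbatim, plus the closed leaf.


Cell qa-qnc0 (HOME `run/shared/lean/pub/qa-qnc0/`, human ruling D-0047): the printed-open problem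
"separations between `QNC⁰` and `AC⁰[p]` WITHOUT giving the quantum circuit an advice state"
(Grewal–Kumar arXiv:2408.16406 §1.3; Watts–Kothari–Schaeffer–Tal arXiv:1906.08890 §1.3;
Grilo–Kashefi–Markham–de Oliveira arXiv:2404.18104 §6; Grier–Schaeffer arXiv:1911.02555 §6),
in the relation-problem reading fixed by planner seat qa-qnc0-p1 (`HOME/qa-qnc0-p1/TARGET.md`,
`Sketch.lean` — the generic statements below are that seat's, verbatim), together with the
candidate hard problem both planner seats converged on: BGK's 2D Hidden Linear Function problem
restricted to CYCLE instances = the ring graph-state relation `RingHLF.Rel` (tree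
`Literature/Computability/QuantumComplexity/ShallowCircuitsRing.lean`; planner seat qa-qnc0-p2's
`RingRel`, `HOME/qa-qnc0-p2/ROUTE.md`).

Statements (all `Prop`s; nothing is claimed here):

* the TARGET `AdviceFreeQNC0Sep p` over the tree's vocabulary (`RelFamily`, `QNC0Solves R δ` —
  advice-free: ancillas initialised to `|0^m⟩`, `m ≤ poly` —, `FACCHard p R θ` — hardness for `FAC⁰[p]`
  circuit tuples with UNIFORM shared random bits, the uniform-`ρ` special case of WKST's `FAC⁰[p]/rpoly`
  (referee erratum E1, REF-ROUND-3 §4: `∀ r` includes `r = 0`, so it implies WKST §1.3's open statement for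
  the plain class `FAC⁰[p]`; the literal arbitrary-advice `/rpoly` form follows from `RingHard` by best-advice
  averaging and is not typed here); `Literature/Computability/QuantumComplexity/ShallowCircuitRelations.lean`):
  some polynomially-bounded relation family is solved with certainty by advice-free `QNC⁰` and is
  hard for `FAC⁰[p]` with uniform shared randomness, with a constant gap;
* `HLFNotFAC0Mod p` — the concrete candidate: 2D HLF is hard for `FAC⁰[p]` with uniform shared randomness
  (constant gap);
* `RingHard p` — the CRUX at the polynomial level: for every `c`, for all large ring lengths `n`,
  every tuple of `𝔽_p`-polynomial maps of degree `≤ (log₂ n)^c` (outputs read as `[P_i(x) = 1]`,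
  tree `Smolensky.lowDeg`) solves the ring relation `RingHLF.Rel x ·` on at most a `θ`-fraction of
  the patterns `x ∈ {0,1}ⁿ`, for a constant `θ < 1`; `RingHard8 p` — the same at lengths `8t` only
  (what the bridge consumes), with `ringHard8_of_ringHard`.

The reductions `RingHard p → HLFNotFAC0Mod p → AdviceFreeQNC0Sep p` are PROVED in
`RingBridge.lean` (this topic); `RingHard 2` is open (the cell's crux; kill tests and structure
theory in the planners' ROUND-1 memos); Relaxed Parity Halving — the README's first candidate —
is in `AC⁰[2]` (tree `ParityHalving.lean`, `exists_circuit_accBasis_two_solves_parityHalving`).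

WHAT THIS IS NOT: not a separation; nothing about `BQP` versus `BPP`; `GC⁰(k)` gates, sampling
problems and interactive variants are out of scope.
-/

open Literature.Computability.Cryptography Literature.Computability.Complexity
open Literature.Computability.QuantumComplexity Literature.Computability.MetaComplexity

namespace Summit.QuantumAdvantage.AdviceFreeQNC0

/-! ### The target (planner qa-qnc0-p1, verbatim, over the Literature vocabulary
`RelFamily` / `QNC0Solves` / `FACCHard` of `ShallowCircuitRelations.lean`) -/

/-- **Target T(p)** (the printed-open statement, relation-problem reading; Grewal–Kumar 2024
§1.3, WKST 2019 §1.3): some relation family with polynomially bounded input length is solved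
with certainty by advice-free `QNC⁰` circuits but is hard for `FAC⁰[p]` circuit tuples with uniform
shared random bits (the uniform-`ρ` case of WKST's `FAC⁰[p]/rpoly`; `r = 0` = plain `FAC⁰[p]`) with
some threshold `θ < 1`. -/
def AdviceFreeQNC0Sep (p : ℕ) : Prop :=
  ∃ R : RelFamily, (∃ b : Polynomial ℕ, ∀ n, R.inLen n ≤ b.eval n) ∧
    QNC0Solves R 0 ∧ ∃ θ : ℝ, θ < 1 ∧ FACCHard p R θ

/-! ### The concrete candidate: BGK's 2D HLF -/

/-- **T₂ (candidate): 2D HLF is hard for FAC⁰[p] with uniform shared randomness** (uniform-`ρ` case of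
`/rpoly`). For every depth `d` and polynomial `s`, for all
large grid sizes `N`, every tuple of `accBasis p`-circuits (`acDepth ≤ d`, size `≤ s N`, one per
grid vertex, reading `encodeHLF I` and `r` random bits) outputs an element of `hlfSolutions I`
with probability `≤ θ` on some valid instance `I` — the classical half of BGK Theorem 1 with
bounded fan-in / depth replaced by `AC⁰[p]`. Printed open for `p = 2`: WKST arXiv:1906.08890
§1.3. -/
def HLFNotFAC0Mod (p : ℕ) : Prop :=
  ∃ θ : ℝ, θ < 1 ∧ ∀ d : ℕ, ∀ s : Polynomial ℕ, ∃ N₀ : ℕ, ∀ N ≥ N₀,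
    ∀ (r : ℕ) (Cs : Fin N × Fin N → Circuit (Fin (inLen N + r))),
      (∀ v, (Cs v).IsOver (accBasis p)) → (∀ v, (Cs v).acDepth ≤ d) →
      (∀ v, (Cs v).size ≤ s.eval N) →
      ∃ I : HLFInstance N, I.IsValid ∧
        uniformProb r
          {ρ | (fun v => (Cs v).eval (Fin.append (encodeHLF I) fun i => ρ.getD i false)) ∈
            hlfSolutions I} ≤ θ

/-! ### The crux: the ring relation versus low-degree polynomial maps -/

/-- **CRUX `RingHard p`** (relational Smolensky bound on the ring; planner seats qa-qnc0-p1
`RingBettingHard`/`CycleNoLowDegResolvent` and qa-qnc0-p2 `RingFrameCrux`, constant-gap form).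
There is `θ < 1` such that for every exponent `c`, for all large ring lengths `n`, every tuple
`P = (P_i)_{i < n}` of functions `{0,1}ⁿ → 𝔽_p` of degree `≤ (log₂ n)^c` (tree
`Smolensky.lowDeg (ZMod p) n`) yields a valid output of the ring relation — `RingHLF.Rel x z` with
`z_i = [P_i(x) = 1]`: "`z` is a possible outcome string of measuring the `n`-cycle graph state in
the bases chosen by `x`" — for at most `θ·2ⁿ` patterns `x`. With `RingBridge.lean`:
`RingHard p → HLFNotFAC0Mod p → AdviceFreeQNC0Sep p`. OPEN (for every prime `p`; `p = 2` is the
cell's case). Why it might fail: a polylog-degree map locating the `S₃`-monodromy eigenline of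
`x` on all but a vanishing fraction of patterns (planner memos ROUND-1, kill tests T1–T4). -/
def RingHard (p : ℕ) [Fact p.Prime] : Prop :=
  open scoped Classical in
  ∃ θ : ℝ, θ < 1 ∧ ∀ c : ℕ, ∃ n₀ : ℕ, ∀ n ≥ n₀,
    ∀ P : Fin n → Smolensky.CubeFn (ZMod p) n,
      (∀ i, P i ∈ Smolensky.lowDeg (ZMod p) n ((Nat.log 2 n) ^ c)) →
      ((Finset.univ.filter fun x : Fin n → Bool =>
          RingHLF.Rel x (fun i => decide (P i x = 1))).card : ℝ) ≤ θ * (2 : ℝ) ^ n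

/-- **`RingHard8 p`** — the same crux asked only at ring lengths `n = 8t` (the lengths the
bridge `RingBridge.lean` actually consumes: boundaries of `2t × 2t` squares in the grid).
`RingHard p → RingHard8 p` trivially; a proof that works only for `n ≡ 0 (mod 8)` suffices for
the target. -/
def RingHard8 (p : ℕ) [Fact p.Prime] : Prop :=
  open scoped Classical in
  ∃ θ : ℝ, θ < 1 ∧ ∀ c : ℕ, ∃ t₀ : ℕ, ∀ t ≥ t₀,
    ∀ P : Fin (8 * t) → Smolensky.CubeFn (ZMod p) (8 * t),
      (∀ i, P i ∈ Smolensky.lowDeg (ZMod p) (8 * t) ((Nat.log 2 (8 * t)) ^ c)) →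
      ((Finset.univ.filter fun x : Fin (8 * t) → Bool =>
          RingHLF.Rel x (fun i => decide (P i x = 1))).card : ℝ) ≤ θ * (2 : ℝ) ^ (8 * t)

/-- `RingHard p → RingHard8 p` (restriction to ring lengths `8t`). -/
theorem ringHard8_of_ringHard (p : ℕ) [Fact p.Prime] (h : RingHard p) : RingHard8 p := by
  obtain ⟨θ, hθ, hh⟩ := h
  refine ⟨θ, hθ, fun c => ?_⟩
  obtain ⟨n₀, hn₀⟩ := hh c
  exact ⟨n₀, fun t ht P hP => hn₀ (8 * t) (by omega) P hP⟩

/-! ### The rung leaf (closed `Prop`, `p = 2`) -/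

/-- **Rung leaf F-Q1 — `AdviceFreeQNC0`** (OPEN PROBLEM, stated — not proved — in print): there is a
relation problem with polynomially bounded input length that advice-free `QNC⁰` circuits solve with
certainty and that is hard, with a constant gap, for `FAC⁰[2]` circuit tuples with uniform shared
random bits; `:= AdviceFreeQNC0Sep 2`. Printed-open: Watts–Kothari–Schaeffer–Tal 2019 §1.3 ("a search
problem in `QNC⁰` that is not in `AC⁰[2]`, or more generally `AC⁰[p]`"); Grewal–Kumar 2024 §1.3
("separations between `QNC⁰` and `GC⁰(k)[p]` without giving the quantum circuit an advice state",
`AC⁰[p]` = the case `k = 1`). The cell's route `RingFrame` concludes this declaration by name via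
`RingHard 2 → HLFNotFAC0Mod 2 → AdviceFreeQNC0Sep 2` (bridge proved by seat qa-qnc0-prover).
WHAT THIS IS NOT: not a theorem; nothing here is asserted; odd `p` (`AdviceFreeQNC0Sep 3`, …) is not
this leaf. [cite: WattsEtAl2019, §1.3] [cite: GrewalKumar2024, §1.3] -/
@[conjecture] def AdviceFreeQNC0 : Prop := AdviceFreeQNC0Sep 2

/-- Unfolding lemma: the leaf is literally `AdviceFreeQNC0Sep 2`. [bookkeeping] -/
theorem adviceFreeQNC0_iff : AdviceFreeQNC0 ↔ AdviceFreeQNC0Sep 2 := Iff.rfl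

end Summit.QuantumAdvantage.AdviceFreeQNC0
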